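import Summits.KontsevichZagierPeriods.Zeta5Search.SymRayZudilinBridge
import Summits.KontsevichZagierPeriods.Zeta5Search.SymmetricFamilyMarginOfTendsto
import HarnessLib

/-!
# ζ(5) search — NEAR-MISSES row 7 (totally symmetric Brown–Zudilin family = Zudilin 2002): every number UNCONDITIONAL (cell `pub-zeta5`, TYPER)

HONEST FRAMING: systematic search; no irrationality claim unless certified.

Row 7 of the cell's `NEAR-MISSES.md` is the totally symmetric cellular family of Brown–Zudilin 2022,
Sect. 2 (`a = n·1⁸`), whose forms are Zudilin's 2002 well-poised approximations to `ζ(5)` under the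
gauge `x_n ↦ (-1)^{n+1} binom(2n,n) x_n`.  The cell's conclusions for this row
(`SymmetricFamilyMargin`, `SymmetricFamilyMarginQ`, `NearMissNoCertificate`, typer/P1) were stated under
the two CITED analytic inputs `BrownZudilin2022.rates` and `Zudilin2002.theorem1_signs`; typer g4/g5
reduced both to the two limit identifications `pₙ/qₙ → ζ(5)`, `p̃ₙ/qₙ → ζ(3)`
(`SymmetricFamilyMarginOfTendsto`), and P1 g3 PROVED the identifications
(`SymRay.theorem1_limits`, whence `SymRay.theorem1_signs_holds`, `SymRay.theorem1_rates_holds`,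
`SymRay.bz_rates_holds`, file `SymRayZudilinBridge`).

This file records the resulting CLOSED statements in the row-7 vocabulary, so that every entry of the
row is a hypothesis-free theorem of the tree:

* `forms_rate` : `log|Q_nζ(5) - P_n|/n → log|λ₂| = -2.4723…` (`λ₂` THE root of `χ` in its bracket);
* `summary`    : `Q_nζ(5) - P_n ≠ 0` (`n ≥ 1`) ∧ scaled-forms rate `log(d_n⁵|Q_nζ(5) - P_n|)/n → r ∈ (2.527, 2.528)`
  (prime number theorem, tree-proved) ∧ the row's MARGIN `c - δ < -2.527` for any admissible exponents ∧ no
  `LinearFormCertificate (ζ(5))` with these forms, denominators `12 d_n⁵`, bounded savings (the separate clauses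
  are the `…_of_tendsto` theorems of `SymmetricFamilyMarginOfTendsto` at `SymRay.theorem1_limits`; the gate's
  dedup rule forbids re-landing them one by one);
* `zudilin_form_ne_zero`, `zudilin_form_tilde_ne_zero` : `qₙζ(5) - pₙ ≠ 0` (`n ≥ 2`), `qₙζ(3) - p̃ₙ ≠ 0` (`n ≥ 3`);
* `zudilin_approx_rate` : `log|ζ(5) - pₙ/qₙ|/n → log μ₂ - log|μ₃| = -8.856014…` with `μ₂, μ₃` THE roots of
  Zudilin's (5) in his brackets.

All proofs are one-line instantiations; 0 sorry.  (Numerical values of the logarithms: referee R11,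
`log|μ₃| = 7.769935…`, `log μ₂ - log|μ₃| = -8.856014…`.)
-/

noncomputable section

open Filter Topology Set
open Literature.NumberTheory.Irrationality
open Literature.NumberTheory.Irrationality.BrownZudilin2022
open Literature.NumberTheory.Irrationality.Zudilin2002 (q p ptilde)
open Literature.NumberTheory.Transcendental (zetaValue)

namespace Summit.KontsevichZagierPeriods.Zeta5Search.Row7

/-- **Decay rate of the `ζ(5)`-forms** (unconditional): `log|Q_nζ(5) - P_n|/n → log|λ₂|` with `λ₂` the root of
`χ(λ) = 4λ³ - 2368λ² - 188λ + 1` in `(-0.0843843162, -0.0843843161)`. -/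
theorem forms_rate : ∃ l₂ : ℝ, BrownZudilin2022.charPoly l₂ = 0 ∧
    l₂ ∈ Ioo (-843843162 / 10 ^ 10 : ℝ) (-843843161 / 10 ^ 10) ∧
    Tendsto (fun n : ℕ => Real.log |(Q n : ℝ) * zetaValue 5 - (P n : ℝ)| / n) atTop
      (𝓝 (Real.log |l₂|)) := by
  obtain ⟨l₂, l₃, h₂, hb₂, -, -, h5, -, -⟩ := SymRay.bz_rates_holds
  exact ⟨l₂, h₂, hb₂, h5⟩

/-- **Row 7, all clauses at once** (unconditional): (i) `Q_nζ(5) - P_n ≠ 0` for `n ≥ 1`; (ii) the scaled-forms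
rate `log(d_n⁵|Q_nζ(5) - P_n|)/n → r ∈ (2.527, 2.528)`; (iii) the MARGIN: eventual bounds
`|Q_nζ(5) - P_n| ≤ e^{-cn}`, `d_n⁵ ≤ e^{δn}` force `c - δ < -2.527`; (iv) no `LinearFormCertificate (ζ(5))` with
these forms, denominators `12 d_n⁵` and bounded savings.  (The individual clauses are
`SymmetricRecursion.forms_ne_zero_of_tendsto / scaled_forms_rate_of_tendsto / margin_lt_of_tendsto /
no_certificate_of_tendsto` applied to P1's `SymRay.theorem1_limits`.) -/
theorem summary :
    (∀ n : ℕ, 1 ≤ n → (Q n : ℝ) * zetaValue 5 - (P n : ℝ) ≠ 0)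
    ∧ (∃ r : ℝ, (2527 / 1000 : ℝ) < r ∧ r < 2528 / 1000 ∧
        Tendsto (fun n : ℕ =>
          Real.log ((Nat.lcmUpto n : ℝ) ^ 5 * |(Q n : ℝ) * zetaValue 5 - (P n : ℝ)|) / n) atTop (𝓝 r))
    ∧ (∀ c δ : ℝ,
        (∀ᶠ n : ℕ in atTop, |(Q n : ℝ) * zetaValue 5 - (P n : ℝ)| ≤ Real.exp (-(c * n))) →
        (∀ᶠ n : ℕ in atTop, ((Nat.lcmUpto n : ℝ)) ^ 5 ≤ Real.exp (δ * n)) → c - δ < -(2527 / 1000))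
    ∧ (∀ K : ℕ, ¬ ∃ cert : LinearFormCertificate (zetaValue 5),
        (∀ n, cert.form n = (Q n : ℝ) * zetaValue 5 - (P n : ℝ))
        ∧ (∀ n, cert.denom n = 12 * Nat.lcmUpto n ^ 5) ∧ (∀ n, cert.saving n ≤ K)) :=
  ⟨fun _ hn => SymmetricRecursion.forms_ne_zero_of_tendsto SymRay.theorem1_limits.1 SymRay.theorem1_limits.2 hn,
    SymmetricRecursion.scaled_forms_rate_of_tendsto SymRay.theorem1_limits.1 SymRay.theorem1_limits.2,
    fun _ _ hc hδ =>
      SymmetricRecursion.margin_lt_of_tendsto SymRay.theorem1_limits.1 SymRay.theorem1_limits.2 hc hδ,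
    fun K => SymmetricRecursion.no_certificate_of_tendsto SymRay.theorem1_limits.1 SymRay.theorem1_limits.2 K⟩

/-! ### Zudilin's normalisation -/

/-- **`qₙζ(5) - pₙ ≠ 0`** for every `n ≥ 2` (unconditional). -/
theorem zudilin_form_ne_zero (n : ℕ) (hn : 2 ≤ n) : (q n : ℝ) * zetaValue 5 - p n ≠ 0 :=
  Zudilin2002Growth.form_ne_zero_of_tendsto SymRay.theorem1_limits.1 n hn

/-- **`qₙζ(3) - p̃ₙ ≠ 0`** for every `n ≥ 3` (unconditional). -/
theorem zudilin_form_tilde_ne_zero (n : ℕ) (hn : 3 ≤ n) : (q n : ℝ) * zetaValue 3 - ptilde n ≠ 0 :=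
  Zudilin2002Growth.form_tilde_ne_zero_of_tendsto SymRay.theorem1_limits.2 n hn

/-- **Exact approximation rate of Zudilin's `pₙ/qₙ` to `ζ(5)`** (unconditional):
`log|ζ(5) - pₙ/qₙ|/n → log μ₂ - log|μ₃|` (`= -8.856014…`), with `μ₂ ∈ (0.33753726, 0.33753727)` and
`μ₃ ∈ (-2368.31752214, -2368.31752213)` THE roots of `μ³ + 2368μ² - 752μ - 16` in those brackets. -/
theorem zudilin_approx_rate :
    ∃ μ₂ μ₃ : ℝ, Zudilin2002.charPoly μ₂ = 0 ∧ μ₂ ∈ Ioo (33753726 / 10 ^ 8 : ℝ) (33753727 / 10 ^ 8) ∧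
      Zudilin2002.charPoly μ₃ = 0 ∧ μ₃ ∈ Ioo (-236831752214 / 10 ^ 8 : ℝ) (-236831752213 / 10 ^ 8) ∧
      Tendsto (fun n : ℕ => Real.log |zetaValue 5 - (p n : ℝ) / q n| / n) atTop
        (𝓝 (Real.log μ₂ - Real.log |μ₃|)) := by
  obtain ⟨L, μ₂, μ₃, hL, h₂, hb₂, h₃, hb₃, hrate⟩ := Zudilin2002Growth.tendsto_log_abs_sub_div
  have hLζ : L = zetaValue 5 := tendsto_nhds_unique hL SymRay.theorem1_limits.1
  subst hLζ
  exact ⟨μ₂, μ₃, h₂, hb₂, h₃, hb₃, hrate⟩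

end Summit.KontsevichZagierPeriods.Zeta5Search.Row7
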